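import Mathlib.Algebra.Algebra.Subalgebra.Centralizer
import Mathlib.RingTheory.Flat.Basic
import Mathlib.LinearAlgebra.FreeModule.Basic
import Literature.Algebra.Lie.EnvelopingAdInvariant
import Literature.NumberTheory.Automorphic.HarishChandraCore
import HarnessLib

/-!
# The enveloping algebra of the Levi blocks `𝔤𝔩_k(ℂ)^T × 𝔤𝔩_l(ℂ)^T ⊆ 𝔤𝔩_{k+l}(ℂ)^T`

Topic `NumberTheory/Automorphic` (support for Harish-Chandra's finiteness theorem, Borel–Jacquet
1979, 4.3 (i), through the constant terms along the maximal parabolic subgroups `P_k` of `GL_n`: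
the transfer of `Z(𝔤)`-finiteness to the Levi subgroup `GL_k × GL_l`, Moeglin–Waldspurger 1995,
I.2.17). Everything is in the complex setting of `HarishChandraCore`: `T` is a finite type,
`𝔤 T m = T → Matrix (Fin m) (Fin m) ℂ` (a product of copies of `𝔤𝔩_m(ℂ)`, commutator bracket),
`U(𝔤 T m)` its complex enveloping algebra.

For `n = k + l` we consider the block diagonal Levi subalgebra `𝔪 = 𝔤 T k × 𝔤 T l ⊆ 𝔤 T (k+l)`
of the standard maximal parabolic `𝔭 = 𝔪 ⊕ 𝔲` and prove the Poincaré–Birkhoff–Witt description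
of the subalgebra `U(𝔪) ⊆ U(𝔤)`:

* `inclLeft`, `inclRight` — the Lie algebra embeddings of the two blocks
  (`X ↦ diag(X, 0)`, `Y ↦ diag(0, Y)`); their images commute (`lie_inclLeft_inclRight`);
  `jLeft`, `jRight` — the induced algebra maps `U(𝔤 T k), U(𝔤 T l) → U(𝔤 T (k+l))`, with
  commuting ranges (`commute_jLeft_jRight`), whence the algebra map
  `leviMap : U(𝔤 T k) ⊗ U(𝔤 T l) → U(𝔤 T (k+l))`, `x ⊗ y ↦ jLeft x · jRight y`.
* `leviMap_tmul_ordMonomial` — **`leviMap` sends PBW monomials to PBW monomials**: for linear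
  orders on the index types making the block embeddings increasing and putting the first block
  before the second, `leviMap (x_s ⊗ x_t) = x_{s' + t'}` (ordered monomials of
  `Literature.Algebra.Lie.PBW.pbwBasis` for the standard bases `HCCore.stdB`).
* `leviMap_injective` — hence **`leviMap` is injective** (Bourbaki, LIE I §2.7 Cor. 5 of Th. 1:
  `U(𝔪) ≅ U(𝔤 T k) ⊗ U(𝔤 T l)` embeds in `U(𝔤)`), and `range_leviMap_eq_leviSpan` — **its range is
  the span of the ordered monomials supported on the Levi indices** (Dixmier 1996, 2.2.7 and
  Prop. 2.4.15 analogue: `U(𝔪)` as the subalgebra of `U(𝔤)` with PBW basis the `𝔪`-monomials).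
* `exists_center_tmul_eq` — **the centre of `U(𝔪)`**: an element of the range of `leviMap`
  commuting with that range is the image of an element of `Z(U(𝔤 T k)) ⊗ Z(U(𝔤 T l))`
  (Mathlib's `Subalgebra.centralizer_coe_range_includeLeft_eq_center_tensorProduct`: the centre of
  a tensor product of algebras over a field is the tensor product of the centres).

These are the inputs of the relative Harish-Chandra homomorphism `Z(𝔤) → Z(𝔪)` along `𝔭`
(file `HarishChandraParabolicProjection`) and of the integrality of `Z(𝔪)` over the image of
`Z(𝔤)` (file `HarishChandraLeviIntegral`), i.e. of the statement "`𝔷^M` is a finitely generated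
`i(𝔷)`-module" of Moeglin–Waldspurger I.2.17 ([HC2] = Harish-Chandra 1968) used to show that
constant terms of automorphic forms are automorphic on the Levi. Everything here is proved:
definitions and theorems only, no named fact.

## References

* J. E. Humphreys, *Introduction to Lie Algebras and Representation Theory*, GTM 9 (1972), §17.3,
  Corollaries C and D (PBW; `U(H) ↪ U(L)` for a subalgebra `H`) [Humphreys1972].
* N. Bourbaki, *Lie Groups and Lie Algebras, Chapters 1–3*, Ch. I §2.7, Th. 1 and Cor. 5.
* J. Dixmier, *Enveloping Algebras*, AMS GSM 11 (1996), 2.2.7–2.2.10, 2.4.15.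
* C. Moeglin, J.-L. Waldspurger, *Spectral decomposition and Eisenstein series*, Cambridge Tracts
  113 (1995), I.2.17 [MoeglinWaldspurger1995].
* Harish-Chandra, *Automorphic forms on semisimple Lie groups*, LNM 62 (1968), §2–§4
  [HarishChandra1968].
-/

noncomputable section

-- Mathlib idiom (Mathlib/Algebra/Lie/OfAssociative.lean): commutator brackets on associative algebras
attribute [local instance 100] LieRing.ofAssociativeRing

open UniversalEnvelopingAlgebra TensorProduct Literature.Algebra.Lie.PBW Literature.Algebra.Lie.ChevalleyGL

namespace Literature.NumberTheory.Automorphic.HCLevi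

open HCCore

variable (T : Type*) (k l : ℕ)

/-! ### Block diagonal matrices indexed by `Fin (k + l)` -/

section BlockDiag

variable {k l}

/-- The block diagonal matrix `diag(X, Y)`, indexed by `Fin (k + l)` (rows and columns
`Fin.castAdd l a` for the first block, `Fin.natAdd k b` for the second). [folklore] -/
def blockDiag (X : Matrix (Fin k) (Fin k) ℂ) (Y : Matrix (Fin l) (Fin l) ℂ) :
    Matrix (Fin (k + l)) (Fin (k + l)) ℂ :=
  Matrix.reindex finSumFinEquiv finSumFinEquiv (Matrix.fromBlocks X 0 0 Y)

/-- Entries of `diag(X, Y)` in the first diagonal block. [folklore] -/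
@[simp]
theorem blockDiag_castAdd_castAdd (X : Matrix (Fin k) (Fin k) ℂ) (Y : Matrix (Fin l) (Fin l) ℂ)
    (a b : Fin k) : blockDiag X Y (Fin.castAdd l a) (Fin.castAdd l b) = X a b := by
  simp [blockDiag]

/-- Entries of `diag(X, Y)` in the upper right block vanish. [folklore] -/
@[simp]
theorem blockDiag_castAdd_natAdd (X : Matrix (Fin k) (Fin k) ℂ) (Y : Matrix (Fin l) (Fin l) ℂ)
    (a : Fin k) (b : Fin l) : blockDiag X Y (Fin.castAdd l a) (Fin.natAdd k b) = 0 := by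
  simp [blockDiag]

/-- Entries of `diag(X, Y)` in the lower left block vanish. [folklore] -/
@[simp]
theorem blockDiag_natAdd_castAdd (X : Matrix (Fin k) (Fin k) ℂ) (Y : Matrix (Fin l) (Fin l) ℂ)
    (a : Fin l) (b : Fin k) : blockDiag X Y (Fin.natAdd k a) (Fin.castAdd l b) = 0 := by
  simp [blockDiag]

/-- Entries of `diag(X, Y)` in the second diagonal block. [folklore] -/
@[simp]
theorem blockDiag_natAdd_natAdd (X : Matrix (Fin k) (Fin k) ℂ) (Y : Matrix (Fin l) (Fin l) ℂ)
    (a b : Fin l) : blockDiag X Y (Fin.natAdd k a) (Fin.natAdd k b) = Y a b := by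
  simp [blockDiag]

/-- `diag` is additive. [folklore] -/
theorem blockDiag_add (X X' : Matrix (Fin k) (Fin k) ℂ) (Y Y' : Matrix (Fin l) (Fin l) ℂ) :
    blockDiag (X + X') (Y + Y') = blockDiag X Y + blockDiag X' Y' := by
  ext i j
  simp only [blockDiag, Matrix.reindex_apply, Matrix.submatrix_apply, Matrix.add_apply]
  rw [← Matrix.add_apply, Matrix.fromBlocks_add]
  simp only [add_zero]

/-- `diag` is homogeneous. [folklore] -/
theorem blockDiag_smul (c : ℂ) (X : Matrix (Fin k) (Fin k) ℂ) (Y : Matrix (Fin l) (Fin l) ℂ) :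
    blockDiag (c • X) (c • Y) = c • blockDiag X Y := by
  ext i j
  simp only [blockDiag, Matrix.reindex_apply, Matrix.submatrix_apply, Matrix.smul_apply]
  rw [← Matrix.smul_apply, Matrix.fromBlocks_smul]
  simp only [smul_zero]

/-- `diag(0, 0) = 0`. [folklore] -/
@[simp]
theorem blockDiag_zero : blockDiag (0 : Matrix (Fin k) (Fin k) ℂ) (0 : Matrix (Fin l) (Fin l) ℂ) = 0 := by
  unfold blockDiag
  rw [Matrix.fromBlocks_zero]
  rfl

/-- `diag(X, Y) - diag(X', Y') = diag(X - X', Y - Y')`. [folklore] -/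
theorem blockDiag_sub (X X' : Matrix (Fin k) (Fin k) ℂ) (Y Y' : Matrix (Fin l) (Fin l) ℂ) :
    blockDiag (X - X') (Y - Y') = blockDiag X Y - blockDiag X' Y' := by
  rw [eq_sub_iff_add_eq, ← blockDiag_add, sub_add_cancel, sub_add_cancel]

/-- `diag` is multiplicative. [folklore] -/
theorem blockDiag_mul (X X' : Matrix (Fin k) (Fin k) ℂ) (Y Y' : Matrix (Fin l) (Fin l) ℂ) :
    blockDiag X Y * blockDiag X' Y' = blockDiag (X * X') (Y * Y') := by
  simp [blockDiag, Matrix.fromBlocks_multiply]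

/-- `diag(1, 1) = 1`. [folklore] -/
@[simp]
theorem blockDiag_one : blockDiag (1 : Matrix (Fin k) (Fin k) ℂ) (1 : Matrix (Fin l) (Fin l) ℂ) = 1 := by
  simp [blockDiag, Matrix.fromBlocks_one]

/-- An index of the first block is never an index of the second. [folklore] -/
theorem castAdd_ne_natAdd (a : Fin k) (b : Fin l) : Fin.castAdd l a ≠ Fin.natAdd k b := by
  intro h
  have h' := congrArg Fin.val h
  simp only [Fin.val_castAdd, Fin.val_natAdd] at h'
  have := a.2
  omega

end BlockDiag

/-! ### Indices: the two blocks inside `Idx T (k + l)`, Levi indices, combined multi-indices -/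

section Indices

variable {T k l}

/-- The index of `𝔤 T (k+l)` corresponding to an index of the first block. [folklore] -/
def embL (i : Idx T k) : Idx T (k + l) := (i.1, Fin.castAdd l i.2.1, Fin.castAdd l i.2.2)

/-- The index of `𝔤 T (k+l)` corresponding to an index of the second block. [folklore] -/
def embR (i : Idx T l) : Idx T (k + l) := (i.1, Fin.natAdd k i.2.1, Fin.natAdd k i.2.2)

/-- `embL` is injective. [folklore] -/
theorem embL_injective : Function.Injective (embL (T := T) (k := k) (l := l)) := by
  rintro ⟨τ, a, b⟩ ⟨τ', a', b'⟩ h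
  simp only [embL, Prod.mk.injEq, Fin.castAdd_inj] at h
  obtain ⟨rfl, rfl, rfl⟩ := h
  rfl

/-- `embR` is injective. [folklore] -/
theorem embR_injective : Function.Injective (embR (T := T) (k := k) (l := l)) := by
  rintro ⟨τ, a, b⟩ ⟨τ', a', b'⟩ h
  simp only [embR, Prod.mk.injEq, Fin.natAdd_inj] at h
  obtain ⟨rfl, rfl, rfl⟩ := h
  rfl

/-- The two blocks of indices are disjoint. [folklore] -/
theorem embL_ne_embR (i : Idx T k) (j : Idx T l) : embL (l := l) i ≠ embR (k := k) j := by
  intro h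
  have h2 := congrArg (fun p : Idx T (k + l) ↦ p.2.1) h
  exact castAdd_ne_natAdd _ _ h2

/-- A Levi index of `𝔤 T (k+l)`: row and column in the same diagonal block. [folklore] -/
def IsLevi (i : Idx T (k + l)) : Prop := ((i.2.1 : ℕ) < k ↔ (i.2.2 : ℕ) < k)

/-- Being a Levi index is decidable. [folklore] -/
instance : DecidablePred (IsLevi (T := T) (k := k) (l := l)) := fun i ↦ by
  unfold IsLevi; infer_instance

/-- Indices of the first block are Levi. [folklore] -/
theorem isLevi_embL (i : Idx T k) : IsLevi (embL (l := l) i) := by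
  simp only [IsLevi, embL, Fin.val_castAdd, i.2.1.2, i.2.2.2]

/-- Indices of the second block are Levi. [folklore] -/
theorem isLevi_embR (j : Idx T l) : IsLevi (embR (k := k) j) := by
  simp only [IsLevi, embR, Fin.val_natAdd]
  omega

/-- **A Levi index lies in one of the two blocks.** [folklore] -/
theorem IsLevi.exists_eq {i : Idx T (k + l)} (hi : IsLevi i) :
    (∃ i₀ : Idx T k, embL i₀ = i) ∨ ∃ j₀ : Idx T l, embR j₀ = i := by
  obtain ⟨τ, a, b⟩ := i
  unfold IsLevi at hi
  dsimp only at hi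
  by_cases ha : (a : ℕ) < k
  · refine Or.inl ⟨(τ, ⟨a, ha⟩, ⟨b, hi.mp ha⟩), ?_⟩
    simp only [embL, Prod.mk.injEq, true_and]
    exact ⟨Fin.ext rfl, Fin.ext rfl⟩
  · have hb : ¬(b : ℕ) < k := fun hb ↦ ha (hi.mpr hb)
    have ha' : (a : ℕ) - k < l := by have := a.2; omega
    have hb' : (b : ℕ) - k < l := by have := b.2; omega
    refine Or.inr ⟨(τ, ⟨a - k, ha'⟩, ⟨b - k, hb'⟩), ?_⟩
    simp only [embR, Prod.mk.injEq, true_and]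
    exact ⟨Fin.ext (by simp; omega), Fin.ext (by simp; omega)⟩

/-- The multi-index of `𝔤 T (k+l)` combining a multi-index of each block. [folklore] -/
def combine (s : Idx T k →₀ ℕ) (t : Idx T l →₀ ℕ) : Idx T (k + l) →₀ ℕ :=
  s.mapDomain embL + t.mapDomain embR

/-- The combined multi-index at an index of the first block. [folklore] -/
theorem combine_embL (s : Idx T k →₀ ℕ) (t : Idx T l →₀ ℕ) (i : Idx T k) : combine s t (embL i) = s i := by
  rw [combine, Finsupp.add_apply, Finsupp.mapDomain_apply embL_injective,
    Finsupp.mapDomain_notin_range, add_zero]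
  rintro ⟨j, hj⟩
  exact embL_ne_embR i j hj.symm

/-- The combined multi-index at an index of the second block. [folklore] -/
theorem combine_embR (s : Idx T k →₀ ℕ) (t : Idx T l →₀ ℕ) (j : Idx T l) : combine s t (embR j) = t j := by
  rw [combine, Finsupp.add_apply, Finsupp.mapDomain_apply embR_injective,
    Finsupp.mapDomain_notin_range, zero_add]
  rintro ⟨i, hi⟩
  exact embL_ne_embR i j hi

/-- `combine` is injective. [folklore] -/
theorem combine_injective : Function.Injective (fun p : (Idx T k →₀ ℕ) × (Idx T l →₀ ℕ) ↦ combine p.1 p.2) := by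
  rintro ⟨s, t⟩ ⟨s', t'⟩ h
  simp only at h
  refine Prod.ext (Finsupp.ext fun i ↦ ?_) (Finsupp.ext fun j ↦ ?_)
  · rw [← combine_embL s t i, h, combine_embL]
  · rw [← combine_embR s t j, h, combine_embR]

/-- **A Levi-supported multi-index is a combination of multi-indices of the two blocks.** [folklore] -/
theorem exists_combine_eq {s : Idx T (k + l) →₀ ℕ} (hs : ∀ i ∈ s.support, IsLevi i) :
    ∃ (s₁ : Idx T k →₀ ℕ) (s₂ : Idx T l →₀ ℕ), combine s₁ s₂ = s := by
  classical
  refine ⟨s.comapDomain embL embL_injective.injOn, s.comapDomain embR embR_injective.injOn, ?_⟩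
  ext i
  by_cases hi : i ∈ s.support
  · rcases (hs i hi).exists_eq with ⟨i₀, rfl⟩ | ⟨j₀, rfl⟩
    · rw [combine_embL, Finsupp.comapDomain_apply]
    · rw [combine_embR, Finsupp.comapDomain_apply]
  · rw [Finsupp.notMem_support_iff.mp hi]
    by_contra h
    have h' : i ∈ (combine (s.comapDomain embL embL_injective.injOn) (s.comapDomain embR embR_injective.injOn)).support :=
      Finsupp.mem_support_iff.mpr h
    rw [combine] at h'
    rcases Finset.mem_union.mp (Finsupp.support_add h') with h1 | h1
    · obtain ⟨i₀, hi₀, rfl⟩ := Finset.mem_image.mp (Finsupp.mapDomain_support h1)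
      rw [Finsupp.comapDomain_support, Finset.mem_preimage] at hi₀
      exact hi hi₀
    · obtain ⟨j₀, hj₀, rfl⟩ := Finset.mem_image.mp (Finsupp.mapDomain_support h1)
      rw [Finsupp.comapDomain_support, Finset.mem_preimage] at hj₀
      exact hi hj₀

/-- A combined multi-index is Levi-supported. [folklore] -/
theorem isLevi_of_mem_support_combine (s₁ : Idx T k →₀ ℕ) (s₂ : Idx T l →₀ ℕ) {i : Idx T (k + l)}
    (hi : i ∈ (combine s₁ s₂).support) : IsLevi i := by
  classical
  rw [combine] at hi
  rcases Finset.mem_union.mp (Finsupp.support_add hi) with h1 | h1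
  · obtain ⟨i₀, -, rfl⟩ := Finset.mem_image.mp (Finsupp.mapDomain_support h1)
    exact isLevi_embL i₀
  · obtain ⟨j₀, -, rfl⟩ := Finset.mem_image.mp (Finsupp.mapDomain_support h1)
    exact isLevi_embR j₀

/-- Sorting commutes with an order embedding. [folklore] -/
theorem sort_map_of_strictMono {α β : Type*} [LinearOrder α] [LinearOrder β] (f : α → β)
    (hf : StrictMono f) (m : Multiset α) : (m.map f).sort = (m.sort).map f :=
  (Multiset.map_sort f m (· ≤ ·) (· ≤ ·) fun _ _ _ _ ↦ hf.le_iff_le.symm).symm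

/-- Sorting a sum of multisets one of which lies entirely (weakly) below the other. [folklore] -/
theorem sort_add_of_forall_le {α : Type*} [LinearOrder α] (m m' : Multiset α)
    (h : ∀ a ∈ m, ∀ b ∈ m', a ≤ b) : (m + m').sort = m.sort ++ m'.sort := by
  symm
  refine List.Perm.eq_of_pairwise (fun a b _ _ h₁ h₂ ↦ le_antisymm h₁ h₂) ?_ (Multiset.pairwise_sort _ _) ?_
  · rw [List.pairwise_append]
    refine ⟨Multiset.pairwise_sort _ _, Multiset.pairwise_sort _ _, fun a ha b hb ↦ ?_⟩
    exact h a ((Multiset.mem_sort _).mp ha) b ((Multiset.mem_sort _).mp hb)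
  · rw [← Multiset.coe_eq_coe, ← Multiset.coe_add, Multiset.sort_eq, Multiset.sort_eq, Multiset.sort_eq]

end Indices

/-! ### The two block embeddings `𝔤 T k, 𝔤 T l ↪ 𝔤 T (k + l)` -/

section Incl

/-- The embedding of the first Levi block: `X ↦ diag(X, 0)`, a Lie algebra homomorphism
`𝔤𝔩_k(ℂ)^T → 𝔤𝔩_{k+l}(ℂ)^T` (factorwise). Knapp 2002, §V.7 (Levi factors of parabolic
subalgebras). [folklore] -/
def inclLeft : 𝔤 T k →ₗ⁅ℂ⁆ 𝔤 T (k + l) where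
  toFun X := fun τ ↦ blockDiag (X τ) (0 : Matrix (Fin l) (Fin l) ℂ)
  map_add' X Y := by
    funext τ
    rw [Pi.add_apply, Pi.add_apply, ← blockDiag_add, add_zero]
  map_smul' c X := by
    funext τ
    rw [Pi.smul_apply, RingHom.id_apply, Pi.smul_apply, ← blockDiag_smul, smul_zero]
  map_lie' {X Y} := by
    funext τ
    rw [LieRing.of_associative_ring_bracket, LieRing.of_associative_ring_bracket, Pi.sub_apply,
      Pi.mul_apply, Pi.mul_apply, Pi.sub_apply, Pi.mul_apply, Pi.mul_apply, blockDiag_mul,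
      blockDiag_mul, ← blockDiag_sub, mul_zero, sub_zero]

/-- The embedding of the second Levi block: `Y ↦ diag(0, Y)`. Knapp 2002, §V.7. [folklore] -/
def inclRight : 𝔤 T l →ₗ⁅ℂ⁆ 𝔤 T (k + l) where
  toFun Y := fun τ ↦ blockDiag (0 : Matrix (Fin k) (Fin k) ℂ) (Y τ)
  map_add' X Y := by
    funext τ
    rw [Pi.add_apply, Pi.add_apply, ← blockDiag_add, add_zero]
  map_smul' c X := by
    funext τ
    rw [Pi.smul_apply, RingHom.id_apply, Pi.smul_apply, ← blockDiag_smul, smul_zero]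
  map_lie' {X Y} := by
    funext τ
    rw [LieRing.of_associative_ring_bracket, LieRing.of_associative_ring_bracket, Pi.sub_apply,
      Pi.mul_apply, Pi.mul_apply, Pi.sub_apply, Pi.mul_apply, Pi.mul_apply, blockDiag_mul,
      blockDiag_mul, ← blockDiag_sub, mul_zero, sub_zero]

variable {T k l}

/-- Unfolding `inclLeft`. [folklore] -/
theorem inclLeft_apply (X : 𝔤 T k) (τ : T) : inclLeft T k l X τ = blockDiag (X τ) 0 := rfl

/-- Unfolding `inclRight`. [folklore] -/
theorem inclRight_apply (Y : 𝔤 T l) (τ : T) : inclRight T k l Y τ = blockDiag 0 (Y τ) := rfl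

/-- **The two blocks commute**: `[diag(X,0), diag(0,Y)] = 0`. [folklore] -/
theorem lie_inclLeft_inclRight (X : 𝔤 T k) (Y : 𝔤 T l) :
    ⁅inclLeft T k l X, inclRight T k l Y⁆ = 0 := by
  funext τ
  rw [LieRing.of_associative_ring_bracket, Pi.sub_apply, Pi.mul_apply, Pi.mul_apply, inclLeft_apply,
    inclRight_apply, blockDiag_mul, blockDiag_mul, mul_zero, zero_mul, mul_zero, zero_mul, sub_self,
    Pi.zero_apply]

variable [Fintype T] [DecidableEq T]

/-- **`inclLeft` on the standard basis**: `diag(E^τ_{ab}, 0) = E^τ_{ab}` (indices in the first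
block). [folklore] -/
theorem inclLeft_stdB (i : Idx T k) : inclLeft T k l (stdB T k i) = stdB T (k + l) (embL i) := by
  obtain ⟨τ, a, b⟩ := i
  funext τ'
  ext x y
  rw [inclLeft_apply]
  induction x using Fin.addCases with
  | left x =>
    induction y using Fin.addCases with
    | left y =>
      rw [blockDiag_castAdd_castAdd, stdB_apply_apply, stdB_apply_apply]
      simp only [embL, Prod.mk.injEq, Fin.castAdd_inj]
    | right y =>
      rw [blockDiag_castAdd_natAdd, stdB_apply_apply, if_neg]
      simp only [embL, Prod.mk.injEq, not_and]
      exact fun _ _ h ↦ castAdd_ne_natAdd _ _ h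
  | right x =>
    induction y using Fin.addCases with
    | left y =>
      rw [blockDiag_natAdd_castAdd, stdB_apply_apply, if_neg]
      simp only [embL, Prod.mk.injEq, not_and]
      exact fun _ h ↦ absurd h (castAdd_ne_natAdd _ _)
    | right y =>
      rw [blockDiag_natAdd_natAdd, Matrix.zero_apply, stdB_apply_apply, if_neg]
      simp only [embL, Prod.mk.injEq, not_and]
      exact fun _ h ↦ absurd h (castAdd_ne_natAdd _ _)

/-- **`inclRight` on the standard basis**: `diag(0, E^τ_{ab}) = E^τ_{k+a,k+b}`. [folklore] -/
theorem inclRight_stdB (i : Idx T l) : inclRight T k l (stdB T l i) = stdB T (k + l) (embR i) := by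
  obtain ⟨τ, a, b⟩ := i
  funext τ'
  ext x y
  rw [inclRight_apply]
  induction x using Fin.addCases with
  | left x =>
    induction y using Fin.addCases with
    | left y =>
      rw [blockDiag_castAdd_castAdd, Matrix.zero_apply, stdB_apply_apply, if_neg]
      simp only [embR, Prod.mk.injEq, not_and]
      exact fun _ h ↦ absurd h.symm (castAdd_ne_natAdd _ _)
    | right y =>
      rw [blockDiag_castAdd_natAdd, stdB_apply_apply, if_neg]
      simp only [embR, Prod.mk.injEq, not_and]
      exact fun _ h ↦ absurd h.symm (castAdd_ne_natAdd _ _)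
  | right x =>
    induction y using Fin.addCases with
    | left y =>
      rw [blockDiag_natAdd_castAdd, stdB_apply_apply, if_neg]
      simp only [embR, Prod.mk.injEq, not_and]
      exact fun _ _ h ↦ castAdd_ne_natAdd _ _ h.symm
    | right y =>
      rw [blockDiag_natAdd_natAdd, stdB_apply_apply, stdB_apply_apply]
      simp only [embR, Prod.mk.injEq, Fin.natAdd_inj]

end Incl

/-! ### The algebra maps on enveloping algebras and the map from the tensor product -/

section Envelope

local notation "𝔘[" m "]" => UniversalEnvelopingAlgebra ℂ (𝔤 T m)

/-- The algebra map `U(𝔤 T k) → U(𝔤 T (k+l))` induced by the first block embedding. [folklore] -/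
def jLeft : 𝔘[k] →ₐ[ℂ] 𝔘[k + l] :=
  UniversalEnvelopingAlgebra.lift ℂ ((ι ℂ).comp (inclLeft T k l))

/-- The algebra map `U(𝔤 T l) → U(𝔤 T (k+l))` induced by the second block embedding. [folklore] -/
def jRight : 𝔘[l] →ₐ[ℂ] 𝔘[k + l] :=
  UniversalEnvelopingAlgebra.lift ℂ ((ι ℂ).comp (inclRight T k l))

variable {T k l}

/-- `jLeft` on generators. [folklore] -/
@[simp]
theorem jLeft_ι (X : 𝔤 T k) : jLeft T k l (ι ℂ X) = ι ℂ (inclLeft T k l X) :=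
  lift_ι_apply ℂ _ X

/-- `jRight` on generators. [folklore] -/
@[simp]
theorem jRight_ι (Y : 𝔤 T l) : jRight T k l (ι ℂ Y) = ι ℂ (inclRight T k l Y) :=
  lift_ι_apply ℂ _ Y

/-- **The ranges of `jLeft` and `jRight` commute** (the two Levi blocks commute, and `U` is
generated by `ι`). [folklore] -/
theorem commute_jLeft_jRight (x : 𝔘[k]) (y : 𝔘[l]) : Commute (jLeft T k l x) (jRight T k l y) := by
  induction x using Literature.Algebra.Lie.UEnv.induction_on with
  | algebraMap r =>
    rw [AlgHom.commutes]
    exact Algebra.commute_algebraMap_left r _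
  | ι_mem X =>
    rw [jLeft_ι]
    induction y using Literature.Algebra.Lie.UEnv.induction_on with
    | algebraMap r =>
      rw [AlgHom.commutes]
      exact Algebra.commute_algebraMap_right r _
    | ι_mem Y =>
      rw [jRight_ι, Commute, SemiconjBy, ← sub_eq_zero, ← LieRing.of_associative_ring_bracket,
        ← LieHom.map_lie, lie_inclLeft_inclRight, map_zero]
    | mul a b ha hb => rw [map_mul]; exact ha.mul_right hb
    | add a b ha hb => rw [map_add]; exact ha.add_right hb
  | mul a b ha hb => rw [map_mul]; exact ha.mul_left hb
  | add a b ha hb => rw [map_add]; exact ha.add_left hb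

variable (T k l) in
/-- **The Levi map** `U(𝔤 T k) ⊗ U(𝔤 T l) → U(𝔤 T (k+l))`, `x ⊗ y ↦ jLeft x · jRight y`: the
algebra homomorphism realising `U(𝔪) = U(𝔤 T k) ⊗ U(𝔤 T l)` inside `U(𝔤)` for the Levi
subalgebra `𝔪 = 𝔤 T k × 𝔤 T l`. Bourbaki, LIE I §2.2 Prop. 2 with §2.7 Cor. 5. [folklore] -/
def leviMap : 𝔘[k] ⊗[ℂ] 𝔘[l] →ₐ[ℂ] 𝔘[k + l] :=
  Algebra.TensorProduct.lift (jLeft T k l) (jRight T k l) commute_jLeft_jRight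

/-- `leviMap` on pure tensors. [folklore] -/
@[simp]
theorem leviMap_tmul (x : 𝔘[k]) (y : 𝔘[l]) : leviMap T k l (x ⊗ₜ y) = jLeft T k l x * jRight T k l y :=
  Algebra.TensorProduct.lift_tmul _ _ _ x y


/-- **Restriction along the first block is the pull-back along `jLeft`**: for a Lie algebra map
`f : 𝔤 T (k+l) → A` into an associative algebra, `lift (f ∘ inclLeft) = lift f ∘ jLeft`. [folklore] -/
theorem lift_comp_inclLeft {A : Type*} [Ring A] [Algebra ℂ A] (f : 𝔤 T (k + l) →ₗ⁅ℂ⁆ A) (x : 𝔘[k]) :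
    UniversalEnvelopingAlgebra.lift ℂ (f.comp (inclLeft T k l)) x =
      UniversalEnvelopingAlgebra.lift ℂ f (jLeft T k l x) := by
  have h : UniversalEnvelopingAlgebra.lift ℂ (f.comp (inclLeft T k l)) =
      (UniversalEnvelopingAlgebra.lift ℂ f).comp (jLeft T k l) := by
    refine UniversalEnvelopingAlgebra.hom_ext (h := LieHom.ext fun X ↦ ?_)
    simp only [LieHom.coe_comp, Function.comp_apply, AlgHom.coe_toLieHom, lift_ι_apply, AlgHom.coe_comp,
      jLeft_ι]
  exact congr($h x)

/-- **Restriction along the second block is the pull-back along `jRight`.** [folklore] -/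
theorem lift_comp_inclRight {A : Type*} [Ring A] [Algebra ℂ A] (f : 𝔤 T (k + l) →ₗ⁅ℂ⁆ A) (y : 𝔘[l]) :
    UniversalEnvelopingAlgebra.lift ℂ (f.comp (inclRight T k l)) y =
      UniversalEnvelopingAlgebra.lift ℂ f (jRight T k l y) := by
  have h : UniversalEnvelopingAlgebra.lift ℂ (f.comp (inclRight T k l)) =
      (UniversalEnvelopingAlgebra.lift ℂ f).comp (jRight T k l) := by
    refine UniversalEnvelopingAlgebra.hom_ext (h := LieHom.ext fun X ↦ ?_)
    simp only [LieHom.coe_comp, Function.comp_apply, AlgHom.coe_toLieHom, lift_ι_apply, AlgHom.coe_comp,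
      jRight_ι]
  exact congr($h y)

/-- Tensors of central elements are central in the tensor product algebra. [folklore] -/
theorem map_center_mem_center (t : Subalgebra.center ℂ 𝔘[k] ⊗[ℂ] Subalgebra.center ℂ 𝔘[l]) :
    Algebra.TensorProduct.map (Subalgebra.center ℂ 𝔘[k]).val (Subalgebra.center ℂ 𝔘[l]).val t ∈
      Subalgebra.center ℂ (𝔘[k] ⊗[ℂ] 𝔘[l]) := by
  induction t using TensorProduct.induction_on with
  | zero => rw [map_zero]; exact Subalgebra.zero_mem _
  | tmul a b =>
    rw [Algebra.TensorProduct.map_tmul, Subalgebra.mem_center_iff]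
    intro w
    induction w using TensorProduct.induction_on with
    | zero => rw [mul_zero, zero_mul]
    | tmul x y =>
      rw [Algebra.TensorProduct.tmul_mul_tmul, Algebra.TensorProduct.tmul_mul_tmul, Subalgebra.coe_val,
        Subalgebra.coe_val, Subalgebra.mem_center_iff.mp a.2 x, Subalgebra.mem_center_iff.mp b.2 y]
    | add x y hx hy => rw [add_mul, mul_add, hx, hy]
  | add x y hx hy => rw [map_add]; exact Subalgebra.add_mem _ hx hy

/-- **`leviMap` of a tensor of central elements commutes with `U(𝔪)`** (the range of `leviMap`).
[folklore] -/
theorem leviMap_center_comm (t : Subalgebra.center ℂ 𝔘[k] ⊗[ℂ] Subalgebra.center ℂ 𝔘[l])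
    (w : 𝔘[k] ⊗[ℂ] 𝔘[l]) :
    leviMap T k l w * leviMap T k l (Algebra.TensorProduct.map (Subalgebra.center ℂ 𝔘[k]).val
        (Subalgebra.center ℂ 𝔘[l]).val t) =
      leviMap T k l (Algebra.TensorProduct.map (Subalgebra.center ℂ 𝔘[k]).val
        (Subalgebra.center ℂ 𝔘[l]).val t) * leviMap T k l w := by
  rw [← map_mul, ← map_mul, Subalgebra.mem_center_iff.mp (map_center_mem_center t) w]

variable [Fintype T] [DecidableEq T]

/-- `jLeft` on words in the standard basis: the same word in the embedded indices. [folklore] -/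
theorem jLeft_word (lst : List (Idx T k)) :
    jLeft T k l (word (stdB T k) lst) = word (stdB T (k + l)) (lst.map embL) := by
  induction lst with
  | nil => rw [word_nil, map_one, List.map_nil, word_nil]
  | cons i lst ih => rw [word_cons, map_mul, ih, jLeft_ι, inclLeft_stdB, List.map_cons, word_cons]

/-- `jRight` on words in the standard basis. [folklore] -/
theorem jRight_word (lst : List (Idx T l)) :
    jRight T k l (word (stdB T l) lst) = word (stdB T (k + l)) (lst.map embR) := by
  induction lst with
  | nil => rw [word_nil, map_one, List.map_nil, word_nil]
  | cons i lst ih => rw [word_cons, map_mul, ih, jRight_ι, inclRight_stdB, List.map_cons, word_cons]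

end Envelope

/-! ### PBW: `leviMap` on ordered monomials, injectivity and range -/

section PBW

local notation "𝔘[" m "]" => UniversalEnvelopingAlgebra ℂ (𝔤 T m)

variable {T k l}
variable [Fintype T] [DecidableEq T] [LinearOrder (Idx T (k + l))]

section OneBlock

variable [LinearOrder (Idx T k)] in
/-- **`jLeft` on ordered monomials**, for an increasing block embedding: `jLeft (x_s) = x_{s'}` with
`s' = s ∘ embL⁻¹`. [folklore] -/
theorem jLeft_ordMonomial (hL : StrictMono (embL (T := T) (k := k) (l := l))) (s : Idx T k →₀ ℕ) :
    jLeft T k l (ordMonomial (stdB T k) s) = ordMonomial (stdB T (k + l)) (s.mapDomain embL) := by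
  rw [ordMonomial, ordMonomial, jLeft_word, ← Finsupp.toMultiset_map, sort_map_of_strictMono _ hL]

variable [LinearOrder (Idx T l)] in
/-- **`jRight` on ordered monomials**, for an increasing block embedding. [folklore] -/
theorem jRight_ordMonomial (hR : StrictMono (embR (T := T) (k := k) (l := l))) (s : Idx T l →₀ ℕ) :
    jRight T k l (ordMonomial (stdB T l) s) = ordMonomial (stdB T (k + l)) (s.mapDomain embR) := by
  rw [ordMonomial, ordMonomial, jRight_word, ← Finsupp.toMultiset_map, sort_map_of_strictMono _ hR]

end OneBlock

variable (T k l) in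
/-- **The Levi span** `U(𝔪) ⊆ U(𝔤 T (k+l))`: the span of the ordered PBW monomials supported on Levi
indices (block diagonal letters only). [cite: Humphreys1972, §17.3 Corollary D] -/
def leviSpan : Submodule ℂ 𝔘[k + l] :=
  Submodule.span ℂ {u | ∃ s : Idx T (k + l) →₀ ℕ, (∀ i ∈ s.support, IsLevi i) ∧ ordMonomial (stdB T (k + l)) s = u}

omit [DecidableEq T] in
/-- Levi-supported ordered monomials lie in the Levi span. [folklore] -/
theorem ordMonomial_mem_leviSpan {s : Idx T (k + l) →₀ ℕ} (hs : ∀ i ∈ s.support, IsLevi i) :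
    ordMonomial (stdB T (k + l)) s ∈ leviSpan T k l :=
  Submodule.subset_span ⟨s, hs, rfl⟩

omit [DecidableEq T] in
/-- The Levi span contains `1`. [folklore] -/
theorem one_mem_leviSpan : (1 : 𝔘[k + l]) ∈ leviSpan T k l := by
  have h := ordMonomial_mem_leviSpan (T := T) (k := k) (l := l) (s := 0) (by simp)
  rwa [ordMonomial_zero] at h

section TwoBlocks

variable [LinearOrder (Idx T k)] [LinearOrder (Idx T l)]

/-- **`leviMap` sends PBW basis vectors to PBW basis vectors**: `leviMap (x_s ⊗ x_t) = x_{s'+t'}`,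
provided the block embeddings are increasing and the first block precedes the second.
[cite: Humphreys1972, §17.3 Corollaries C–D] -/
theorem leviMap_tmul_ordMonomial (hL : StrictMono (embL (T := T) (k := k) (l := l)))
    (hR : StrictMono (embR (T := T) (k := k) (l := l)))
    (hLR : ∀ (i : Idx T k) (j : Idx T l), embL (l := l) i < embR (k := k) j)
    (s : Idx T k →₀ ℕ) (t : Idx T l →₀ ℕ) :
    leviMap T k l (ordMonomial (stdB T k) s ⊗ₜ ordMonomial (stdB T l) t) =
      ordMonomial (stdB T (k + l)) (combine s t) := by
  rw [leviMap_tmul, jLeft_ordMonomial hL, jRight_ordMonomial hR, ordMonomial, ordMonomial, ordMonomial,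
    ← word_append, combine, Finsupp.toMultiset_add, sort_add_of_forall_le]
  intro a ha b hb
  rw [← Finsupp.toMultiset_map, Multiset.mem_map] at ha hb
  obtain ⟨i, -, rfl⟩ := ha
  obtain ⟨j, -, rfl⟩ := hb
  exact (hLR i j).le

/-- `leviMap` on the tensor product PBW basis. [folklore] -/
theorem leviMap_basis (hL : StrictMono (embL (T := T) (k := k) (l := l)))
    (hR : StrictMono (embR (T := T) (k := k) (l := l)))
    (hLR : ∀ (i : Idx T k) (j : Idx T l), embL (l := l) i < embR (k := k) j)
    (p : (Idx T k →₀ ℕ) × (Idx T l →₀ ℕ)) :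
    leviMap T k l ((pbwBasis (stdB T k)).tensorProduct (pbwBasis (stdB T l)) p) =
      pbwBasis (stdB T (k + l)) (combine p.1 p.2) := by
  rw [Module.Basis.tensorProduct_apply', pbwBasis_apply, pbwBasis_apply, pbwBasis_apply,
    leviMap_tmul_ordMonomial hL hR hLR]

/-- `leviMap` in coordinates: the PBW coordinates of `leviMap w` are the tensor PBW coordinates of `w`
transported along `combine`. [folklore] -/
theorem repr_leviMap (hL : StrictMono (embL (T := T) (k := k) (l := l)))
    (hR : StrictMono (embR (T := T) (k := k) (l := l)))
    (hLR : ∀ (i : Idx T k) (j : Idx T l), embL (l := l) i < embR (k := k) j) (w : 𝔘[k] ⊗[ℂ] 𝔘[l]) :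
    (pbwBasis (stdB T (k + l))).repr (leviMap T k l w) =
      (((pbwBasis (stdB T k)).tensorProduct (pbwBasis (stdB T l))).repr w).mapDomain
        (fun p ↦ combine p.1 p.2) := by
  conv_lhs => rw [← ((pbwBasis (stdB T k)).tensorProduct (pbwBasis (stdB T l))).linearCombination_repr w]
  rw [Finsupp.linearCombination_apply, map_finsuppSum, map_finsuppSum, Finsupp.mapDomain]
  simp only [Finsupp.sum]
  refine Finset.sum_congr rfl fun p _ ↦ ?_
  rw [map_smul, map_smul, leviMap_basis hL hR hLR, Module.Basis.repr_self, Finsupp.smul_single, smul_eq_mul,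
    mul_one]

/-- **`leviMap` is injective**: `U(𝔤 T k) ⊗ U(𝔤 T l) ≅ U(𝔪) ⊆ U(𝔤 T (k+l))`.
[cite: Humphreys1972, §17.3 Corollary D] -/
theorem leviMap_injective (hL : StrictMono (embL (T := T) (k := k) (l := l)))
    (hR : StrictMono (embR (T := T) (k := k) (l := l)))
    (hLR : ∀ (i : Idx T k) (j : Idx T l), embL (l := l) i < embR (k := k) j) :
    Function.Injective (leviMap T k l) := by
  intro w w' h
  have h' := congrArg (pbwBasis (stdB T (k + l))).repr h
  rw [repr_leviMap hL hR hLR, repr_leviMap hL hR hLR] at h'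
  exact ((pbwBasis (stdB T k)).tensorProduct (pbwBasis (stdB T l))).repr.injective
    (Finsupp.mapDomain_injective combine_injective h')

/-- **The range of `leviMap` is the Levi span** (PBW for the subalgebra `U(𝔪)`).
[cite: Humphreys1972, §17.3 Corollary D] -/
theorem range_leviMap_eq_leviSpan (hL : StrictMono (embL (T := T) (k := k) (l := l)))
    (hR : StrictMono (embR (T := T) (k := k) (l := l)))
    (hLR : ∀ (i : Idx T k) (j : Idx T l), embL (l := l) i < embR (k := k) j) :
    LinearMap.range (leviMap T k l).toLinearMap = leviSpan T k l := by
  set B := (pbwBasis (stdB T k)).tensorProduct (pbwBasis (stdB T l)) with hB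
  refine le_antisymm ?_ ?_
  · rintro _ ⟨w, rfl⟩
    rw [AlgHom.toLinearMap_apply, ← B.linearCombination_repr w, Finsupp.linearCombination_apply,
      map_finsuppSum]
    refine Submodule.finsuppSum_mem _ _ _ _ fun p _ ↦ ?_
    rw [map_smul, leviMap_basis hL hR hLR, pbwBasis_apply]
    exact Submodule.smul_mem _ _ (ordMonomial_mem_leviSpan fun i hi ↦ isLevi_of_mem_support_combine _ _ hi)
  · refine Submodule.span_le.mpr ?_
    rintro _ ⟨s, hs, rfl⟩
    obtain ⟨s₁, s₂, rfl⟩ := exists_combine_eq hs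
    exact ⟨ordMonomial (stdB T k) s₁ ⊗ₜ ordMonomial (stdB T l) s₂, leviMap_tmul_ordMonomial hL hR hLR s₁ s₂⟩

/-- In particular the Levi span is a subalgebra: it is closed under multiplication. [folklore] -/
theorem mul_mem_leviSpan (hL : StrictMono (embL (T := T) (k := k) (l := l)))
    (hR : StrictMono (embR (T := T) (k := k) (l := l)))
    (hLR : ∀ (i : Idx T k) (j : Idx T l), embL (l := l) i < embR (k := k) j) {x y : 𝔘[k + l]}
    (hx : x ∈ leviSpan T k l) (hy : y ∈ leviSpan T k l) : x * y ∈ leviSpan T k l := by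
  rw [← range_leviMap_eq_leviSpan hL hR hLR] at hx hy ⊢
  obtain ⟨w, rfl⟩ := hx
  obtain ⟨w', rfl⟩ := hy
  exact ⟨w * w', by rw [AlgHom.toLinearMap_apply, map_mul]; rfl⟩

/-- The images of `jLeft` lie in the Levi span. [folklore] -/
theorem jLeft_mem_leviSpan (hL : StrictMono (embL (T := T) (k := k) (l := l)))
    (hR : StrictMono (embR (T := T) (k := k) (l := l)))
    (hLR : ∀ (i : Idx T k) (j : Idx T l), embL (l := l) i < embR (k := k) j) (x : 𝔘[k]) :
    jLeft T k l x ∈ leviSpan T k l := by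
  rw [← range_leviMap_eq_leviSpan hL hR hLR]
  exact ⟨x ⊗ₜ 1, by rw [AlgHom.toLinearMap_apply, leviMap_tmul, map_one, mul_one]⟩

/-- The images of `jRight` lie in the Levi span. [folklore] -/
theorem jRight_mem_leviSpan (hL : StrictMono (embL (T := T) (k := k) (l := l)))
    (hR : StrictMono (embR (T := T) (k := k) (l := l)))
    (hLR : ∀ (i : Idx T k) (j : Idx T l), embL (l := l) i < embR (k := k) j) (y : 𝔘[l]) :
    jRight T k l y ∈ leviSpan T k l := by
  rw [← range_leviMap_eq_leviSpan hL hR hLR]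
  exact ⟨1 ⊗ₜ y, by rw [AlgHom.toLinearMap_apply, leviMap_tmul, map_one, one_mul]⟩

/-! ### The centre of `U(𝔪)` -/

/-- **The centre of the Levi subalgebra is the tensor product of the centres of the blocks**: an
element of `U(𝔪) = leviMap (U(𝔤 T k) ⊗ U(𝔤 T l))` commuting with `U(𝔪)` is the image of an
element of `Z(U(𝔤 T k)) ⊗ Z(U(𝔤 T l))` (the centre of a tensor product of algebras over a field is
the tensor product of the centres; Mathlib's
`Subalgebra.centralizer_coe_range_includeLeft_eq_center_tensorProduct`). [folklore] -/
theorem exists_center_tmul_eq (hL : StrictMono (embL (T := T) (k := k) (l := l)))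
    (hR : StrictMono (embR (T := T) (k := k) (l := l)))
    (hLR : ∀ (i : Idx T k) (j : Idx T l), embL (l := l) i < embR (k := k) j) {y : 𝔘[k + l]}
    (hy : y ∈ leviSpan T k l) (hcomm : ∀ x ∈ leviSpan T k l, x * y = y * x) :
    ∃ t : Subalgebra.center ℂ 𝔘[k] ⊗[ℂ] Subalgebra.center ℂ 𝔘[l],
      leviMap T k l (Algebra.TensorProduct.map (Subalgebra.center ℂ 𝔘[k]).val
        (Subalgebra.center ℂ 𝔘[l]).val t) = y := by
  rw [← range_leviMap_eq_leviSpan hL hR hLR] at hy hcomm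
  obtain ⟨t₀, rfl⟩ := hy
  have hinj := leviMap_injective hL hR hLR
  -- `t₀` is central in the tensor product
  have hcen : ∀ w : 𝔘[k] ⊗[ℂ] 𝔘[l], w * t₀ = t₀ * w := fun w ↦
    hinj (by rw [map_mul, map_mul]; exact hcomm _ ⟨w, rfl⟩)
  -- hence in `Z ⊗ U(𝔤 T l)`
  have h1 : t₀ ∈ Subalgebra.centralizer ℂ
      ((Algebra.TensorProduct.includeLeft : 𝔘[k] →ₐ[ℂ] 𝔘[k] ⊗[ℂ] 𝔘[l]).range : Set (𝔘[k] ⊗[ℂ] 𝔘[l])) := by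
    rw [Subalgebra.mem_centralizer_iff]
    exact fun w _ ↦ hcen w
  rw [Subalgebra.centralizer_coe_range_includeLeft_eq_center_tensorProduct] at h1
  obtain ⟨t₁, rfl⟩ := (AlgHom.mem_range _).mp h1
  -- `t₁` commutes with `1 ⊗ U(𝔤 T l)`
  have hinj₁ : Function.Injective (Algebra.TensorProduct.map (Subalgebra.center ℂ 𝔘[k]).val
      (AlgHom.id ℂ 𝔘[l])) :=
    TensorProduct.map_injective_of_flat_flat _ _ Subtype.val_injective Function.injective_id
  have h2 : t₁ ∈ Subalgebra.centralizer ℂ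
      ((Algebra.TensorProduct.includeRight : 𝔘[l] →ₐ[ℂ] Subalgebra.center ℂ 𝔘[k] ⊗[ℂ] 𝔘[l]).range :
        Set (Subalgebra.center ℂ 𝔘[k] ⊗[ℂ] 𝔘[l])) := by
    rw [Subalgebra.mem_centralizer_iff]
    intro x hx
    obtain ⟨b, rfl⟩ := (AlgHom.mem_range _).mp hx
    refine hinj₁ ?_
    rw [map_mul, map_mul]
    have e : Algebra.TensorProduct.map (Subalgebra.center ℂ 𝔘[k]).val (AlgHom.id ℂ 𝔘[l])
        (Algebra.TensorProduct.includeRight b) = (1 : 𝔘[k]) ⊗ₜ b := by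
      rw [Algebra.TensorProduct.includeRight_apply, Algebra.TensorProduct.map_tmul, map_one, AlgHom.id_apply]
    rw [e]
    exact hcen _
  rw [Subalgebra.centralizer_range_includeRight_eq_center_tensorProduct] at h2
  obtain ⟨t₂, rfl⟩ := (AlgHom.mem_range _).mp h2
  refine ⟨t₂, ?_⟩
  have e := Algebra.TensorProduct.map_comp (Subalgebra.center ℂ 𝔘[k]).val (AlgHom.id ℂ _)
    (AlgHom.id ℂ 𝔘[l]) (Subalgebra.center ℂ 𝔘[l]).val
  rw [AlgHom.comp_id, AlgHom.id_comp] at e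
  rw [e, AlgHom.comp_apply]
  rfl

end TwoBlocks

end PBW

end Literature.NumberTheory.Automorphic.HCLevi
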